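import Summits.AtomisticToContinuum.Crystallization.Theorems.FrustratedLawDichotomyCellF1cFloor
import Summits.AtomisticToContinuum.Crystallization.Theorems.FrustratedLawDichotomyCellArithNashIntFlat
import Summits.AtomisticToContinuum.Crystallization.Theorems.FrustratedLawDichotomyCellArithGram

/-!
# FrustratedLawDichotomy · crux `AperiodicFrustratedLawGap` (stmt-AtomisticToContinuum-27623) — class-A K-file tower, layer 9c:
# THE NASH NEAR-COLUMN KIT of the F1 cell over `MF1c` (decomp-a2c hand-2 g49; the `hnn` binder of #121 `…CellF1cFloor`)

#121 reduced the F1 K-certificate `CertF1c` to ONE column: per label `m` of the NASH list `MNc` a number `nn m` bounding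
`‖ψ(‖pos m‖²)•pos m − certCoeffNearL MF1c MIF1 pos Y (ballL MF1c zT 23) m‖` uniformly over the strain cell.  hand-1's all-integer NASH kernel
(`…CellArithNashInt[Flat]`: per-pair boxes, lead box, norm step `…ArithGram.norm_posL_le_of_gramHiZ2`) certifies exactly this from INTEGER data,
but its assembly sums over `Finset` filters of the 14 153-label set, which the kernel cannot enumerate.  This KIT makes the kernel's work LIST-SIZED:
* §1 F1 IS A SCALED INTEGER TEMPLATE: `aF1 m = (1/16384)·zF m`, `zF m := (10477·m₁, 11706·m₂, 11706·m₃)`, `omF1 = omZ/2²⁴` (the `ha`/`hω` binders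
  with `hn = 1`, `hd = 16384`, `D = 2²⁴`, `ε = 1/1024`);
* §2 CLASS READINGS WITHOUT TABLES: for `d ≠ 0`, `g_F(aF1 d, aF1 d) ∈ [loZ (qkF d), hiZ (qkF d)]` (#96/#98), `0 < loZ`, so `PLq/PHq/P1Lq/P1Hq (qkF d)` :=
  hand-1 `psiLoZ/psiHiZ/psi1LoZ/psi1HiZ` at `S = 2⁴⁰` bracket `S·ψ`, `S·ψ′` there (`readings_aF1`);
* §3 NEAR PARTNERS AS 224-TERM LISTS: `D224` (the parity vectors `0 < |d|² < 23`, `D224_complete`), `ownL m := (D224.map (m + ·)).filter admLc`,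
  `nbrL m := (…).filter admI` ENUMERATE the two filter sets of `nashVecLab` (`ownSet_eq`, `nbrSet_eq`), with `Nodup`;
* §4 `pairBoxF` := hand-1's FLAT per-pair box `linLabIF` at the class readings; `sum6` folds a list of pair boxes ONCE; `nashBox m` = the six integers
  `(WL₀, WH₀, WL₁, WH₁, WL₂, WH₂)` (lead ∓ own ± interior partners; `m ∈ MIF1` read as `admI m`); ★★ `nashBox_mem`: they bound
  `Σ·nashVecLab (FᵀF) MF1c MIF1 aF1 omF1 nb m` coordinatewise (`leadI_mem` + `linLabIF_mem` summed over the lists; `SIG = 2¹⁰²`);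
* §5 ★★ `hrep_of_nnCheck` — ONE Boolean `nnCheck m l₀ h₀ l₁ h₁ l₂ h₂ b` (the generator's literal box CONTAINS `nashBox m`, `0 ≤ b`,
  `gramHiZ2 Glo Ghi l h ≤ SIG²·b²`; ≈ 20 ms per pair in the kernel, ≤ 443 pairs per label) implies, for every `F ∈ BF1`, the `hnn` inequality of #121
  at `m` with the number `b` — the per-REPRESENTATIVE input of #116 `nn_of_reps_aF1c`.  Layer 9d (data) = the table on the 239 `rep16`-classes of `MNc`.
Imports TREE #121 `…CellF1cFloor`, hand-1 `…CellArithNashIntFlat`, `…CellArithGram`; computable `def`s + theorems; 0 sorry.  Tags: [new: K-file layer].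
-/


namespace Summit.AtomisticToContinuum.Crystallization.Theorems.FrustratedLawDichotomyCellF1cNearKit

open scoped BigOperators
open Summit.AtomisticToContinuum.Crystallization.Theorems.ChargedEnergyGapNegative (E3)
open Summit.AtomisticToContinuum.Crystallization.Theorems.FrustratedLawDichotomyCoherentFloorAlgebra (psiT psiT1)
open Summit.AtomisticToContinuum.Crystallization.Theorems.FrustratedLawDichotomyCellTails (certCoeffNearL)
open Summit.AtomisticToContinuum.Crystallization.Theorems.FrustratedLawDichotomyCellMetric (posL gram linLab nashVecLab nashVec_posL norm_sq_posL)
open Summit.AtomisticToContinuum.Crystallization.Theorems.FrustratedLawDichotomyCellData (norm_sq_mem_nearId)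
open Summit.AtomisticToContinuum.Crystallization.Theorems.FrustratedLawDichotomyCellClasses (ballL)
open Summit.AtomisticToContinuum.Crystallization.Theorems.FrustratedLawDichotomyCellTriples (zT sumT sqT subT mem_ballL_zT sumT_subT)
open Summit.AtomisticToContinuum.Crystallization.Theorems.FrustratedLawDichotomyCellArithLJ
  (psiLoZ psiHiZ psi1LoZ psi1HiZ psiLoZ_le le_psiHiZ psi1LoZ_le le_psi1HiZ)
open Summit.AtomisticToContinuum.Crystallization.Theorems.FrustratedLawDichotomyCellArithGram (gramHiZ2 norm_posL_le_of_gramHiZ2)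
open Summit.AtomisticToContinuum.Crystallization.Theorems.FrustratedLawDichotomyCellArithNashInt (leadILo leadIHi leadI_mem)
open Summit.AtomisticToContinuum.Crystallization.Theorems.FrustratedLawDichotomyCellArithNashIntFlat (linLabIF linLabIF_mem)
open Summit.AtomisticToContinuum.Crystallization.Theorems.FrustratedLawDichotomyCellF1Frame (T TQ qk qk_eq BL BI admL admI admL_iff admI_iff)
open Summit.AtomisticToContinuum.Crystallization.Theorems.FrustratedLawDichotomyCellF1Labels
  (boxF1 mem_boxF1 boxF1_nodup labF1 intF1 MF1 MIF1 qkF qkF_eq mem_M mem_MI mem_labF1)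
open Summit.AtomisticToContinuum.Crystallization.Theorems.FrustratedLawDichotomyCellF1cLabels
  (MF1c BLc admLc admLc_iff mem_Mc MI_subset_Mc hparc M_subset_Mc)
open Summit.AtomisticToContinuum.Crystallization.Theorems.FrustratedLawDichotomyCellF1Symm (BF1)
open Summit.AtomisticToContinuum.Crystallization.Theorems.FrustratedLawDichotomyCellF1Pos (aF1)
open Summit.AtomisticToContinuum.Crystallization.Theorems.FrustratedLawDichotomyCellF1ClassWin (loF1 hiF1 hloW_F1 hhiW_F1 qk_ne_zero_of_ne)
open Summit.AtomisticToContinuum.Crystallization.Theorems.FrustratedLawDichotomyCellF1HostTable (loZ hiZ)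
open Summit.AtomisticToContinuum.Crystallization.Theorems.FrustratedLawDichotomyCellF1HostCol (loZ_cast hiZ_cast)
open Summit.AtomisticToContinuum.Crystallization.Theorems.FrustratedLawDichotomyCellF1Omega (omZ omF1)
open Summit.AtomisticToContinuum.Crystallization.Theorems.FrustratedLawDichotomyCellF1Debit (SZ SZ_pos)
open Summit.AtomisticToContinuum.Crystallization.Theorems.FrustratedLawDichotomyCellF1cNear (qk_le_of_sqT sqT_subT_zero)
open Summit.AtomisticToContinuum.Crystallization.Theorems.FrustratedLawDichotomyCellF1cFloor (aF1_subT eq_of_subT_eq_zero)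

/-! ## §1 F1 as a scaled integer template -/

/-- the integer label vector of F1 (the dyadic template `T = diag(10477, 11706, 11706)/16384` cleared of its denominator). -/
def zF (m : ℤ × ℤ × ℤ) : Fin 3 → ℤ := ![10477 * m.1, 11706 * m.2.1, 11706 * m.2.2]
/-- the multiplier denominator `D = 2²⁴`. -/
def DZ : ℤ := 16777216
/-- the NASH scale `Σ = S·D·ed·hd² = 2⁴⁰·2²⁴·2¹⁰·16384²`. -/
def SIG : ℤ := SZ * DZ * 1024 * 16384 ^ 2
/-- componentwise sum of triples. -/
def addT (m d : ℤ × ℤ × ℤ) : ℤ × ℤ × ℤ := (m.1 + d.1, m.2.1 + d.2.1, m.2.2 + d.2.2)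
/-- ★ (ha) `aF1 m j = (1/16384)·zF m j`. -/
theorem aF1_zF (m : ℤ × ℤ × ℤ) (j : Fin 3) : aF1 m j = ((1 : ℤ) : ℝ) / ((16384 : ℤ) : ℝ) * (zF m j : ℝ) := by
  show (T.mulVec fun j => (zT m j : ℝ)) j = _
  fin_cases j <;> simp [T, TQ, zF, zT, Matrix.mulVec, dotProduct, Fin.sum_univ_three] <;> ring
/-- (hω) `omF1 m j = omZ m j / D`. -/
theorem omF1_DZ (m : ℤ × ℤ × ℤ) (j : Fin 3) : omF1 m j = (omZ m j : ℝ) / ((DZ : ℤ) : ℝ) := by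
  show (omZ m j : ℝ) / 2 ^ 24 = _
  unfold DZ; push_cast; norm_num
/-- `0 < D`. -/
theorem DZ_pos : 0 < DZ := by unfold DZ; norm_num
/-- `0 < Σ`. -/
theorem SIG_pos : 0 < SIG := by unfold SIG DZ; exact mul_pos (mul_pos (mul_pos SZ_pos (by norm_num)) (by norm_num)) (by norm_num)

/-! ## §2 Class readings without tables -/

/-- lower reading of `2⁴⁰·ψ` on the class window of key `q`. -/
def PLq (q : ℤ) : ℤ := psiLoZ SZ (loZ q) (hiZ q)
/-- upper reading of `2⁴⁰·ψ` on the class window of key `q`. -/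
def PHq (q : ℤ) : ℤ := psiHiZ SZ (loZ q) (hiZ q)
/-- lower reading of `2⁴⁰·ψ′` on the class window of key `q`. -/
def P1Lq (q : ℤ) : ℤ := psi1LoZ SZ (loZ q) (hiZ q)
/-- upper reading of `2⁴⁰·ψ′` on the class window of key `q`. -/
def P1Hq (q : ℤ) : ℤ := psi1HiZ SZ (loZ q) (hiZ q)
/-- the class window is positive off the root: `0 < loZ (qkF d)` for `d ≠ 0`. -/
theorem loZ_pos {d : ℤ × ℤ × ℤ} (hd : d ≠ 0) : 0 < loZ (qkF d) := by
  have hq : 0 < qk d := lt_of_le_of_ne (Summit.AtomisticToContinuum.Crystallization.Theorems.FrustratedLawDichotomyCellF1Frame.qk_nonneg d)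
    (Ne.symm (qk_ne_zero_of_ne hd))
  rw [qkF_eq]; unfold loZ
  have : (0 : ℚ) < qk d := by exact_mod_cast hq
  positivity
/-- ★ the Gram value of a placed label vector sits in its class window, for every `F` of the cell. -/
theorem gram_aF1_mem {F : Matrix (Fin 3) (Fin 3) ℝ} (hG : ∀ i j, |(F.transpose * F) i j - (if i = j then 1 else 0)| ≤ 1 / 1024) (d : ℤ × ℤ × ℤ) :
    ((loZ (qkF d) : ℚ) : ℝ) ≤ gram (F.transpose * F) (aF1 d) (aF1 d) ∧ gram (F.transpose * F) (aF1 d) (aF1 d) ≤ ((hiZ (qkF d) : ℚ) : ℝ) := by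
  have h := norm_sq_mem_nearId hG (aF1 d)
  rw [norm_sq_posL] at h
  exact ⟨by rw [loZ_cast]; exact (hloW_F1 d).trans h.1, by rw [hiZ_cast]; exact h.2.trans (hhiW_F1 d)⟩
/-- ★ THE FOUR READINGS at class key `qkF d`, `d ≠ 0`: `PLq ≤ S·ψ(g) ≤ PHq`, `P1Lq ≤ S·ψ′(g) ≤ P1Hq` at `g = g_F(aF1 d, aF1 d)`. -/
theorem readings_aF1 {F : Matrix (Fin 3) (Fin 3) ℝ} (hG : ∀ i j, |(F.transpose * F) i j - (if i = j then 1 else 0)| ≤ 1 / 1024) {d : ℤ × ℤ × ℤ}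
    (hd : d ≠ 0) :
    ((PLq (qkF d) : ℤ) : ℝ) ≤ SZ * psiT (gram (F.transpose * F) (aF1 d) (aF1 d))
      ∧ SZ * psiT (gram (F.transpose * F) (aF1 d) (aF1 d)) ≤ ((PHq (qkF d) : ℤ) : ℝ)
      ∧ ((P1Lq (qkF d) : ℤ) : ℝ) ≤ SZ * psiT1 (gram (F.transpose * F) (aF1 d) (aF1 d))
      ∧ SZ * psiT1 (gram (F.transpose * F) (aF1 d) (aF1 d)) ≤ ((P1Hq (qkF d) : ℤ) : ℝ) := by
  obtain ⟨h1, h2⟩ := gram_aF1_mem hG d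
  have h0 := loZ_pos hd
  exact ⟨psiLoZ_le SZ_pos h0 h1 h2, le_psiHiZ SZ_pos h0 h1 h2, psi1LoZ_le SZ_pos h0 h1 h2, le_psi1HiZ SZ_pos h0 h1 h2⟩

/-! ## §3 The near partners as 224-term lists -/

/-- ★ THE 224 PARITY DIFFERENCES `0 < |d|² < 23`, enumerated from the 729-candidate box `[-4,4]³` (kernel-cheap, so that the partner lists never
re-enumerate the 68 921-candidate label box; `irreducible` so that no elaborator `whnf` ever materialises it). -/
@[irreducible] def D224 : List (ℤ × ℤ × ℤ) := (boxF1 4 4).filter fun d => (sumT d % 2 == 0) && decide (0 < sqT d) && decide (sqT d < 23)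
/-- members: `|d|² < 23` and `d ≠ 0` (decided). -/
theorem D224_facts : ∀ d ∈ D224, sqT d < 23 ∧ d ≠ 0 := by decide +kernel
/-- the box part of completeness (decided over the 729 candidates). -/
theorem D224_box : ∀ d ∈ boxF1 4 4, Even (sumT d) → d ≠ 0 → sqT d < 23 → d ∈ D224 := by decide +kernel
/-- ★ COMPLETENESS: every nonzero parity vector with `|d|² < 23` is one of the 224. -/
theorem D224_complete {d : ℤ × ℤ × ℤ} (hpar : Even (sumT d)) (hd0 : d ≠ 0) (hs : sqT d < 23) : d ∈ D224 := by
  unfold sqT at hs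
  have h1 : |d.1| ≤ 4 := abs_le.mpr ⟨by nlinarith [sq_nonneg d.2.1, sq_nonneg d.2.2], by nlinarith [sq_nonneg d.2.1, sq_nonneg d.2.2]⟩
  have h2 : |d.2.1| ≤ 4 := abs_le.mpr ⟨by nlinarith [sq_nonneg d.1, sq_nonneg d.2.2], by nlinarith [sq_nonneg d.1, sq_nonneg d.2.2]⟩
  have h3 : |d.2.2| ≤ 4 := abs_le.mpr ⟨by nlinarith [sq_nonneg d.1, sq_nonneg d.2.1], by nlinarith [sq_nonneg d.1, sq_nonneg d.2.1]⟩
  exact D224_box d (mem_boxF1.mpr ⟨by exact_mod_cast h1, by exact_mod_cast h2, by exact_mod_cast h3⟩) hpar hd0 (by unfold sqT; exact hs)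
/-- no duplicates (a filter of the duplicate-free box). -/
theorem D224_nodup : D224.Nodup := by unfold D224; exact (boxF1_nodup 4 4).filter _
/-- own-multiplier partners of `m`: complete labels `m + d`, `0 < |d|² < 23`. -/
@[irreducible] def ownL (m : ℤ × ℤ × ℤ) : List (ℤ × ℤ × ℤ) := (D224.map (addT m)).filter fun x => admLc x
/-- interior partners of `m`: interior labels `m + d`, `0 < |d|² < 23`. -/
@[irreducible] def nbrL (m : ℤ × ℤ × ℤ) : List (ℤ × ℤ × ℤ) := (D224.map (addT m)).filter fun x => admI x
/-- `addT m` is injective. -/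
theorem addT_injective (m : ℤ × ℤ × ℤ) : Function.Injective (addT m) := by
  intro d d' h
  obtain ⟨a, b, c⟩ := d
  obtain ⟨a', b', c'⟩ := d'
  simp only [addT, Prod.mk.injEq] at h
  obtain ⟨h1, h2, h3⟩ := h
  refine Prod.ext ?_ (Prod.ext ?_ ?_) <;> simp <;> omega
/-- `(m + d) − m = d`. -/
theorem subT_addT (m d : ℤ × ℤ × ℤ) : subT (addT m d) m = d := by
  obtain ⟨a, b, c⟩ := d
  simp only [subT, addT]
  refine Prod.ext ?_ (Prod.ext ?_ ?_) <;> simp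
/-- `m + (x − m) = x`. -/
theorem addT_subT (m x : ℤ × ℤ × ℤ) : addT m (subT x m) = x := by
  obtain ⟨a, b, c⟩ := x
  simp only [subT, addT]
  refine Prod.ext ?_ (Prod.ext ?_ ?_) <;> simp
/-- `m + d = m ⇒ d = 0`. -/
theorem eq_zero_of_addT_eq {m d : ℤ × ℤ × ℤ} (h : addT m d = m) : d = 0 := by
  have := subT_addT m d
  rw [h] at this
  rw [← this]
  obtain ⟨a, b, c⟩ := m
  simp [subT]
/-- the lists have no duplicates. -/
theorem ownL_nodup (m : ℤ × ℤ × ℤ) : (ownL m).Nodup := by unfold ownL; exact (D224_nodup.map (addT_injective m)).filter _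
/-- idem. -/
theorem nbrL_nodup (m : ℤ × ℤ × ℤ) : (nbrL m).Nodup := by unfold nbrL; exact (D224_nodup.map (addT_injective m)).filter _
/-- a difference of two parity labels with `|d|² < 23`, `d ≠ 0`, is one of the 224. -/
theorem subT_mem_D224 {x m : ℤ × ℤ × ℤ} (hx : Even (sumT x)) (hm : Even (sumT m)) (hs : sqT (subT x m) < 23) (hne : x ≠ m) :
    subT x m ∈ D224 := by
  have hpar : Even (sumT (subT x m)) := by rw [sumT_subT]; exact hx.sub hm
  exact D224_complete hpar (fun h => hne (eq_of_subT_eq_zero h)) hs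
/-- ★ the own-partner filter set of `nashVecLab` IS the list `ownL m` (for a complete label `m`). -/
theorem ownSet_eq {m : ℤ × ℤ × ℤ} (hm : m ∈ MF1c) :
    (MF1c.erase m).filter (fun m' => m' ∈ ballL MF1c zT 23 m) = (ownL m).toFinset := by
  ext x
  simp only [Finset.mem_filter, Finset.mem_erase, List.mem_toFinset, ownL, List.mem_filter, List.mem_map, mem_ballL_zT]
  constructor
  · rintro ⟨⟨hne, hxM⟩, -, hs⟩
    exact ⟨⟨subT x m, subT_mem_D224 (hparc x hxM) (hparc m hm) hs hne, addT_subT m x⟩, mem_Mc.mp hxM⟩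
  · rintro ⟨⟨d, hd, rfl⟩, hadm⟩
    obtain ⟨hs, hd0⟩ := D224_facts d hd
    have hxM : addT m d ∈ MF1c := mem_Mc.mpr hadm
    exact ⟨⟨fun h => hd0 (eq_zero_of_addT_eq h), hxM⟩, hxM, by rw [subT_addT]; exact hs⟩
/-- ★ the interior-partner filter set of `nashVecLab` IS the list `nbrL m` (for a complete label `m`). -/
theorem nbrSet_eq {m : ℤ × ℤ × ℤ} (hm : m ∈ MF1c) :
    (MIF1.erase m).filter (fun x => x ∈ ballL MF1c zT 23 m) = (nbrL m).toFinset := by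
  ext x
  simp only [Finset.mem_filter, Finset.mem_erase, List.mem_toFinset, nbrL, List.mem_filter, List.mem_map, mem_ballL_zT]
  constructor
  · rintro ⟨⟨hne, hxI⟩, hxM, hs⟩
    exact ⟨⟨subT x m, subT_mem_D224 (hparc x hxM) (hparc m hm) hs hne, addT_subT m x⟩, mem_MI.mp hxI⟩
  · rintro ⟨⟨d, hd, rfl⟩, hadm⟩
    obtain ⟨hs, hd0⟩ := D224_facts d hd
    have hxI : addT m d ∈ MIF1 := mem_MI.mpr hadm
    exact ⟨⟨fun h => hd0 (eq_zero_of_addT_eq h), hxI⟩, MI_subset_Mc hxI, by rw [subT_addT]; exact hs⟩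

/-! ## §4 The flat per-pair boxes, folded ONCE into the six integers of a label -/

/-- lower entry box of `FᵀF` on the cell. -/
def Glo : Fin 3 → Fin 3 → ℚ := fun i j => if i = j then 1 - 1 / 1024 else -(1 / 1024)
/-- upper entry box of `FᵀF` on the cell. -/
def Ghi : Fin 3 → Fin 3 → ℚ := fun i j => if i = j then 1 + 1 / 1024 else 1 / 1024
/-- hand-1's FLAT per-pair box `(lo₀, hi₀, lo₁, hi₁, lo₂, hi₂)` of `Σ·linLab` at the class readings of key `q`, integer pair data `z`, `w`. -/
def pairBoxF (q : ℤ) (z w : Fin 3 → ℤ) : ℤ × ℤ × ℤ × ℤ × ℤ × ℤ :=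
  linLabIF (PLq q) (PHq q) (P1Lq q) (P1Hq q) 1024 1 1 16384 (z 0) (z 1) (z 2) (w 0) (w 1) (w 2)
/-- componentwise sum of six-tuples (one fold: every pair box is computed ONCE). -/
def sum6 : List (ℤ × ℤ × ℤ × ℤ × ℤ × ℤ) → ℤ × ℤ × ℤ × ℤ × ℤ × ℤ
  | [] => (0, 0, 0, 0, 0, 0)
  | b :: l => match sum6 l with
    | (s0, s1, s2, s3, s4, s5) => (b.1 + s0, b.2.1 + s1, b.2.2.1 + s2, b.2.2.2.1 + s3, b.2.2.2.2.1 + s4, b.2.2.2.2.2 + s5)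
/-- the fold is the six coordinate sums. -/
theorem sum6_eq (l : List (ℤ × ℤ × ℤ × ℤ × ℤ × ℤ)) :
    sum6 l = ((l.map fun b => b.1).sum, (l.map fun b => b.2.1).sum, (l.map fun b => b.2.2.1).sum, (l.map fun b => b.2.2.2.1).sum,
      (l.map fun b => b.2.2.2.2.1).sum, (l.map fun b => b.2.2.2.2.2).sum) := by
  induction l with
  | nil => rfl
  | cons b l ih => simp only [sum6, ih, List.map_cons, List.sum_cons]
/-- the own-pair boxes of `m`, folded. -/
@[irreducible] def ownBox (m : ℤ × ℤ × ℤ) : ℤ × ℤ × ℤ × ℤ × ℤ × ℤ :=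
  sum6 ((ownL m).map fun m' => pairBoxF (qkF (subT m m')) (zF m - zF m') (omZ m))
/-- the interior-partner boxes of `m`, folded. -/
@[irreducible] def nbrBox (m : ℤ × ℤ × ℤ) : ℤ × ℤ × ℤ × ℤ × ℤ × ℤ :=
  sum6 ((nbrL m).map fun x => pairBoxF (qkF (subT x m)) (zF x - zF m) (omZ x))
/-- ★ THE SIX INTEGERS OF A LABEL `(WL₀, WH₀, WL₁, WH₁, WL₂, WH₂)`: lead box ∓ own boxes (if interior) ± interior-partner boxes —
the list form of hand-1's `nashILo/nashIHi`, flat and fold-shared (the kernel evaluates THIS, once per label). -/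
@[irreducible] def nashBox (m : ℤ × ℤ × ℤ) : ℤ × ℤ × ℤ × ℤ × ℤ × ℤ :=
  let q := qkF m
  let nb := nbrBox m
  let ob : ℤ × ℤ × ℤ × ℤ × ℤ × ℤ := if admI m = true then ownBox m else (0, 0, 0, 0, 0, 0)
  (leadILo (PLq q) (PHq q) DZ 1024 1 16384 (zF m) 0 - ob.2.1 + nb.1, leadIHi (PLq q) (PHq q) DZ 1024 1 16384 (zF m) 0 - ob.1 + nb.2.1,
    leadILo (PLq q) (PHq q) DZ 1024 1 16384 (zF m) 1 - ob.2.2.2.1 + nb.2.2.1,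
    leadIHi (PLq q) (PHq q) DZ 1024 1 16384 (zF m) 1 - ob.2.2.1 + nb.2.2.2.1,
    leadILo (PLq q) (PHq q) DZ 1024 1 16384 (zF m) 2 - ob.2.2.2.2.2 + nb.2.2.2.2.1,
    leadIHi (PLq q) (PHq q) DZ 1024 1 16384 (zF m) 2 - ob.2.2.2.2.1 + nb.2.2.2.2.2)

section Sound

variable {F : Matrix (Fin 3) (Fin 3) ℝ} (hG : ∀ i j, |(F.transpose * F) i j - (if i = j then 1 else 0)| ≤ 1 / 1024)
include hG
/-- the per-pair flat box at a nonzero difference `d` bounds `Σ·linLab (aF1 d) (omF1 y)` with data `zF d`, `omZ y`. -/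
theorem pairBoxF_mem {d : ℤ × ℤ × ℤ} (hd : d ≠ 0) (y : ℤ × ℤ × ℤ) {z : Fin 3 → ℤ} (hz : z = zF d) :
    let B := pairBoxF (qkF d) z (omZ y)
    let Sg : ℝ := ((SIG : ℤ) : ℝ)
    ((B.1 : ℝ) ≤ Sg * linLab (F.transpose * F) (aF1 d) (omF1 y) 0 ∧ Sg * linLab (F.transpose * F) (aF1 d) (omF1 y) 0 ≤ (B.2.1 : ℝ))
      ∧ ((B.2.2.1 : ℝ) ≤ Sg * linLab (F.transpose * F) (aF1 d) (omF1 y) 1 ∧ Sg * linLab (F.transpose * F) (aF1 d) (omF1 y) 1 ≤ (B.2.2.2.1 : ℝ))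
      ∧ ((B.2.2.2.2.1 : ℝ) ≤ Sg * linLab (F.transpose * F) (aF1 d) (omF1 y) 2
        ∧ Sg * linLab (F.transpose * F) (aF1 d) (omF1 y) 2 ≤ (B.2.2.2.2.2 : ℝ)) := by
  subst hz
  obtain ⟨p1, p2, p3, p4⟩ := readings_aF1 hG hd
  have hε : (1 / 1024 : ℝ) = ((1 : ℤ) : ℝ) / ((1024 : ℤ) : ℝ) := by norm_num
  exact linLabIF_mem (S := SZ) (D := DZ) (G := F.transpose * F) (z := zF d) (w := omZ y) (a := aF1 d) (ω := omF1 y)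
    hG hε (by norm_num) DZ_pos (by norm_num) (aF1_zF d) (omF1_DZ y) p1 p2 p3 p4
/-- ★★ **THE SIX INTEGERS BOUND `Σ·nashVecLab`** (complete non-root label `m`): coordinatewise
`WLᵢ ≤ Σ·(nashVecLab (FᵀF) MF1c MIF1 aF1 omF1 (ballL MF1c zT 23) m) i ≤ WHᵢ`. -/
theorem nashBox_mem {m : ℤ × ℤ × ℤ} (hm : m ∈ MF1c) (hm0 : m ≠ 0) :
    ((((nashBox m).1 : ℤ) : ℝ) ≤ ((SIG : ℤ) : ℝ) * nashVecLab (F.transpose * F) MF1c MIF1 aF1 omF1 (ballL MF1c zT 23) m 0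
        ∧ ((SIG : ℤ) : ℝ) * nashVecLab (F.transpose * F) MF1c MIF1 aF1 omF1 (ballL MF1c zT 23) m 0 ≤ (((nashBox m).2.1 : ℤ) : ℝ))
      ∧ ((((nashBox m).2.2.1 : ℤ) : ℝ) ≤ ((SIG : ℤ) : ℝ) * nashVecLab (F.transpose * F) MF1c MIF1 aF1 omF1 (ballL MF1c zT 23) m 1
        ∧ ((SIG : ℤ) : ℝ) * nashVecLab (F.transpose * F) MF1c MIF1 aF1 omF1 (ballL MF1c zT 23) m 1 ≤ (((nashBox m).2.2.2.1 : ℤ) : ℝ))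
      ∧ ((((nashBox m).2.2.2.2.1 : ℤ) : ℝ) ≤ ((SIG : ℤ) : ℝ) * nashVecLab (F.transpose * F) MF1c MIF1 aF1 omF1 (ballL MF1c zT 23) m 2
        ∧ ((SIG : ℤ) : ℝ) * nashVecLab (F.transpose * F) MF1c MIF1 aF1 omF1 (ballL MF1c zT 23) m 2 ≤ (((nashBox m).2.2.2.2.2 : ℤ) : ℝ)) := by
  -- lead term
  have hL := fun i : Fin 3 => leadI_mem (S := SZ) (D := DZ) (ed := 1024) (G := F.transpose * F) (i := i) (z := zF m) (a := aF1 m)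
    (hn := 1) (hd := 16384) (PL := PLq (qkF m)) (PH := PHq (qkF m)) (by norm_num) (aF1_zF m) (readings_aF1 hG hm0).1 (readings_aF1 hG hm0).2.1
  -- per-pair boxes on the two lists
  have hO : ∀ m' ∈ (ownL m).toFinset, _ := fun m' hm' => by
    have hne : m' ≠ m := (Finset.mem_erase.mp (Finset.mem_filter.mp ((ownSet_eq hm).symm ▸ hm')).1).1
    have hd : subT m m' ≠ 0 := fun h => hne (eq_of_subT_eq_zero h).symm
    have hz : zF m - zF m' = zF (subT m m') := by
      funext j; obtain ⟨a, b, c⟩ := m; obtain ⟨a', b', c'⟩ := m'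
      fin_cases j <;> simp [zF, subT] <;> ring
    exact pairBoxF_mem hG hd m hz
  have hN : ∀ x ∈ (nbrL m).toFinset, _ := fun x hx => by
    have hne : x ≠ m := (Finset.mem_erase.mp (Finset.mem_filter.mp ((nbrSet_eq hm).symm ▸ hx)).1).1
    have hd : subT x m ≠ 0 := fun h => hne (eq_of_subT_eq_zero h)
    have hz : zF x - zF m = zF (subT x m) := by
      funext j; obtain ⟨a, b, c⟩ := x; obtain ⟨a', b', c'⟩ := m
      fin_cases j <;> simp [zF, subT] <;> ring
    exact pairBoxF_mem hG hd x hz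
  -- the algebra of nashVecLab, with the filter sets as the lists
  have eV : ∀ i, nashVecLab (F.transpose * F) MF1c MIF1 aF1 omF1 (ballL MF1c zT 23) m i = (psiT (gram (F.transpose * F) (aF1 m) (aF1 m)) • aF1 m) i
      - (if m ∈ MIF1 then ∑ m' ∈ (ownL m).toFinset, linLab (F.transpose * F) (aF1 m - aF1 m') (omF1 m) i else 0)
      + ∑ x ∈ (nbrL m).toFinset, linLab (F.transpose * F) (aF1 x - aF1 m) (omF1 x) i := by
    intro i
    unfold nashVecLab
    rw [← ownSet_eq hm, ← nbrSet_eq hm]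
    by_cases h : m ∈ MIF1
    · simp [h, Finset.sum_apply]; ring
    · simp [h, Finset.sum_apply]
  have eA : ∀ m', aF1 m - aF1 m' = aF1 (subT m m') := fun m' => (aF1_subT m m').symm
  have eB : ∀ x, aF1 x - aF1 m = aF1 (subT x m) := fun x => (aF1_subT x m).symm
  simp only [eA, eB] at eV
  -- list folds = Finset sums over the lists
  have eO := sum6_eq ((ownL m).map fun m' => pairBoxF (qkF (subT m m')) (zF m - zF m') (omZ m))
  have eN := sum6_eq ((nbrL m).map fun x => pairBoxF (qkF (subT x m)) (zF x - zF m) (omZ x))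
  simp only [List.map_map, Function.comp_def] at eO eN
  have sO : ∀ f : ℤ × ℤ × ℤ → ℤ, ((ownL m).map f).sum = ∑ m' ∈ (ownL m).toFinset, f m' := fun f => (List.sum_toFinset _ (ownL_nodup m)).symm
  have sN : ∀ f : ℤ × ℤ × ℤ → ℤ, ((nbrL m).map f).sum = ∑ x ∈ (nbrL m).toFinset, f x := fun f => (List.sum_toFinset _ (nbrL_nodup m)).symm
  simp only [sO, sN] at eO eN
  -- sum the per-pair bounds
  have SO1 := fun (p : ℤ × ℤ × ℤ × ℤ × ℤ × ℤ → ℤ) (i : Fin 3) (h : ∀ m' ∈ (ownL m).toFinset,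
      ((p (pairBoxF (qkF (subT m m')) (zF m - zF m') (omZ m)) : ℤ) : ℝ) ≤ (SIG : ℝ) * linLab (F.transpose * F) (aF1 (subT m m')) (omF1 m) i) =>
    Summit.AtomisticToContinuum.Crystallization.Theorems.FrustratedLawDichotomyCellArithGram.finsetSum_readings_le SIG _ _ _ h
  have SO2 := fun (p : ℤ × ℤ × ℤ × ℤ × ℤ × ℤ → ℤ) (i : Fin 3) (h : ∀ m' ∈ (ownL m).toFinset,
      (SIG : ℝ) * linLab (F.transpose * F) (aF1 (subT m m')) (omF1 m) i ≤ ((p (pairBoxF (qkF (subT m m')) (zF m - zF m') (omZ m)) : ℤ) : ℝ)) =>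
    Summit.AtomisticToContinuum.Crystallization.Theorems.FrustratedLawDichotomyCellArithGram.le_finsetSum_readings SIG _ _ _ h
  have SN1 := fun (p : ℤ × ℤ × ℤ × ℤ × ℤ × ℤ → ℤ) (i : Fin 3) (h : ∀ x ∈ (nbrL m).toFinset,
      ((p (pairBoxF (qkF (subT x m)) (zF x - zF m) (omZ x)) : ℤ) : ℝ) ≤ (SIG : ℝ) * linLab (F.transpose * F) (aF1 (subT x m)) (omF1 x) i) =>
    Summit.AtomisticToContinuum.Crystallization.Theorems.FrustratedLawDichotomyCellArithGram.finsetSum_readings_le SIG _ _ _ h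
  have SN2 := fun (p : ℤ × ℤ × ℤ × ℤ × ℤ × ℤ → ℤ) (i : Fin 3) (h : ∀ x ∈ (nbrL m).toFinset,
      (SIG : ℝ) * linLab (F.transpose * F) (aF1 (subT x m)) (omF1 x) i ≤ ((p (pairBoxF (qkF (subT x m)) (zF x - zF m) (omZ x)) : ℤ) : ℝ)) =>
    Summit.AtomisticToContinuum.Crystallization.Theorems.FrustratedLawDichotomyCellArithGram.le_finsetSum_readings SIG _ _ _ h
  have O0L := SO1 (fun b => b.1) 0 (fun m' h => (hO m' h).1.1)
  have O0H := SO2 (fun b => b.2.1) 0 (fun m' h => (hO m' h).1.2)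
  have O1L := SO1 (fun b => b.2.2.1) 1 (fun m' h => (hO m' h).2.1.1)
  have O1H := SO2 (fun b => b.2.2.2.1) 1 (fun m' h => (hO m' h).2.1.2)
  have O2L := SO1 (fun b => b.2.2.2.2.1) 2 (fun m' h => (hO m' h).2.2.1)
  have O2H := SO2 (fun b => b.2.2.2.2.2) 2 (fun m' h => (hO m' h).2.2.2)
  have N0L := SN1 (fun b => b.1) 0 (fun x h => (hN x h).1.1)
  have N0H := SN2 (fun b => b.2.1) 0 (fun x h => (hN x h).1.2)
  have N1L := SN1 (fun b => b.2.2.1) 1 (fun x h => (hN x h).2.1.1)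
  have N1H := SN2 (fun b => b.2.2.2.1) 1 (fun x h => (hN x h).2.1.2)
  have N2L := SN1 (fun b => b.2.2.2.2.1) 2 (fun x h => (hN x h).2.2.1)
  have N2H := SN2 (fun b => b.2.2.2.2.2) 2 (fun x h => (hN x h).2.2.2)
  have hS : ((SZ * DZ * 1024 * 16384 ^ 2 : ℤ) : ℝ) = ((SIG : ℤ) : ℝ) := by rfl
  rw [hS] at hL
  have L0 := hL 0
  have L1 := hL 1
  have L2 := hL 2
  rw [eV 0, eV 1, eV 2]
  by_cases hI : admI m = true
  · have hI' : m ∈ MIF1 := mem_MI.mpr hI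
    simp only [nashBox, ownBox, nbrBox, eO, eN, hI, hI', if_true]
    push_cast at O0L O0H O1L O1H O2L O2H N0L N0H N1L N1H N2L N2H L0 L1 L2 ⊢
    simp only [mul_add, mul_sub]
    refine ⟨⟨?_, ?_⟩, ⟨?_, ?_⟩, ⟨?_, ?_⟩⟩ <;> linarith
  · have hI' : m ∉ MIF1 := fun h => hI (mem_MI.mp h)
    simp only [nashBox, ownBox, nbrBox, eO, eN, hI, hI', if_false, Bool.false_eq_true]
    push_cast at N0L N0H N1L N1H N2L N2H L0 L1 L2 ⊢
    simp only [mul_add, sub_zero]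
    refine ⟨⟨?_, ?_⟩, ⟨?_, ?_⟩, ⟨?_, ?_⟩⟩ <;> linarith

end Sound

/-! ## §5 ★★ The per-representative check and its soundness -/

/-- ★ THE KERNEL CHECK of a label's NASH number `b` against a LITERAL box `(l₀, h₀, l₁, h₁, l₂, h₂)` (from the generator): the literal box
contains the computed one (six comparisons, ONE evaluation of `nashBox`), `0 ≤ b`, and `gramHiZ2 Glo Ghi l h ≤ Σ²·b²` on the literals. -/
def nnCheck (m : ℤ × ℤ × ℤ) (l0 h0 l1 h1 l2 h2 : ℤ) (b : ℚ) : Bool :=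
  (match nashBox m with
    | (w0, v0, w1, v1, w2, v2) =>
      decide (l0 ≤ w0) && decide (v0 ≤ h0) && decide (l1 ≤ w1) && decide (v1 ≤ h1) && decide (l2 ≤ w2) && decide (v2 ≤ h2))
    && decide (0 ≤ b) && decide (((gramHiZ2 Glo Ghi ![l0, l1, l2] ![h0, h1, h2] : ℤ) : ℚ) ≤ (SIG : ℚ) ^ 2 * b ^ 2)
/-- ★★ **SOUNDNESS OF THE CHECK** (the per-representative input of #116 `nn_of_reps_aF1c`): for a complete non-root label `m` with `nnCheck m … b`, and
every `F` of the strain cell, `‖ψ(‖pos m‖²)•pos m − certCoeffNearL MF1c MIF1 (posL F ∘ aF1) (posL F ∘ omF1) (ballL MF1c zT 23) m‖ ≤ b`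
(`nashBox_mem` + hand-1 `norm_posL_le_of_gramHiZ2` + (252) `nashVec_posL`). [new: K-file layer] -/
theorem hrep_of_nnCheck {m : ℤ × ℤ × ℤ} (hm : m ∈ MF1c) (hm0 : m ≠ 0) {l0 h0 l1 h1 l2 h2 : ℤ} {b : ℚ}
    (hc : nnCheck m l0 h0 l1 h1 l2 h2 b = true) :
    ∀ F ∈ BF1, ‖psiT (‖posL F (aF1 m)‖ ^ 2) • posL F (aF1 m)
        - certCoeffNearL MF1c MIF1 (fun x => posL F (aF1 x)) (fun x => posL F (omF1 x)) (ballL MF1c zT 23) m‖ ≤ (b : ℝ) := by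
  intro F hF
  have hG : ∀ i j, |(F.transpose * F) i j - (if i = j then 1 else 0)| ≤ 1 / 1024 := hF
  have hB := nashBox_mem hG hm hm0
  revert hc hB
  rcases hW : nashBox m with ⟨w0, v0, w1, v1, w2, v2⟩
  intro hc hB
  simp only [nnCheck, hW, Bool.and_eq_true, decide_eq_true_eq] at hc
  obtain ⟨⟨⟨⟨⟨⟨⟨c1, c2⟩, c3⟩, c4⟩, c5⟩, c6⟩, hb⟩, hcert⟩ := hc
  obtain ⟨⟨B1, B2⟩, ⟨B3, B4⟩, ⟨B5, B6⟩⟩ := hB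
  have hGlo : ∀ i j, ((Glo i j : ℚ) : ℝ) ≤ (F.transpose * F) i j := by
    intro i j; have h := (abs_le.1 (hG i j)).1; unfold Glo; split_ifs with hij <;> push_cast <;> simp [hij] at h ⊢ <;> linarith
  have hGhi : ∀ i j, (F.transpose * F) i j ≤ ((Ghi i j : ℚ) : ℝ) := by
    intro i j; have h := (abs_le.1 (hG i j)).2; unfold Ghi; split_ifs with hij <;> push_cast <;> simp [hij] at h ⊢ <;> linarith
  have key := norm_posL_le_of_gramHiZ2 (S := SIG) F (W := nashVecLab (F.transpose * F) MF1c MIF1 aF1 omF1 (ballL MF1c zT 23) m)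
    (WL := ![l0, l1, l2]) (WH := ![h0, h1, h2]) SIG_pos hGlo hGhi
    (fun i => by
      fin_cases i
      · exact le_trans (by exact_mod_cast c1) B1
      · exact le_trans (by exact_mod_cast c3) B3
      · exact le_trans (by exact_mod_cast c5) B5)
    (fun i => by
      fin_cases i
      · exact le_trans B2 (by exact_mod_cast c2)
      · exact le_trans B4 (by exact_mod_cast c4)
      · exact le_trans B6 (by exact_mod_cast c6)) hb hcert
  rw [nashVec_posL F MF1c MIF1 aF1 omF1 (ballL MF1c zT 23) m]
  exact key

end Summit.AtomisticToContinuum.Crystallization.Theorems.FrustratedLawDichotomyCellF1cNearKit
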